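import Mathlib.NumberTheory.Zsqrtd.Basic
import Mathlib.RingTheory.PrincipalIdealDomain
import Mathlib.Algebra.EuclideanDomain.Basic
import Mathlib.Algebra.EuclideanDomain.Int
import Mathlib.Tactic
import HarnessLib

/-!
# Fermat's `y² + 2 = x³` via `ℤ[√−2]` (Ireland–Rosen, §17.10)

K. Ireland, M. Rosen, *A Classical Introduction to Modern Number Theory* [IrelandRosen1990], Ch. 17,
§10 (p. 285 of the text): *`y² = x³ − 2` has only the integral solutions `(3, ±5)`* — "a very
short proof can be given using Exercise 36 of Chapter 1" (that `ℤ[√−2]` is Euclidean): in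
`(y + √−2)(y − √−2) = x³` the factors are coprime (`y` odd), `ℤ[√−2]` has unique factorisation and
units `±1`, so `y + √−2 = (a + b√−2)³`, whence `1 = b(3a² − 2b²)`, `b = 1`, `a = ±1`, `y = ∓5`,
`x = 3`. Everything here is a `theorem`, except the (computable) Euclidean-domain structure on
`ℤ√(−2)` — norm-Euclidean division with rounding, the content of I&R Ch. 1 Ex. 36 — which is data.

Mathlib has `Zsqrtd d` for every `d` and the Euclidean structure only for `d = −1`
(`GaussianInt`); the tree uses `ℤ√(-2)` as a ring (`LanglandsTunnellModThree.lean`) but has no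
Euclidean structure on it (`lean search 'EuclideanDomain \(ℤ√'` — nothing).
-/

namespace Literature.NumberTheory.DiophantineGeometry

namespace ZsqrtdNegTwo

open Zsqrtd

/-- Rounded integer division: `rdiv u N` is an integer `q` with `|u − Nq| ≤ N/2` (`N > 0`).
[cite: IrelandRosen1990, Ch. 1, Ex. 36] -/
def rdiv (u N : ℤ) : ℤ := (2 * u + N) / (2 * N)

/-- The rounding bound `|2(u − N·rdiv u N)| ≤ N`. [cite: IrelandRosen1990, Ch. 1, Ex. 36] -/
theorem two_mul_abs_sub_rdiv (u : ℤ) {N : ℤ} (hN : 0 < N) :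
    (2 * (u - N * rdiv u N)) ^ 2 ≤ N ^ 2 := by
  unfold rdiv
  set q := (2 * u + N) / (2 * N) with hq
  have h1 : 0 ≤ (2 * u + N) % (2 * N) := Int.emod_nonneg _ (by omega)
  have h2 : (2 * u + N) % (2 * N) < 2 * N := Int.emod_lt_of_pos _ (by omega)
  have h3 : (2 * u + N) % (2 * N) = 2 * u + N - 2 * N * q := by
    rw [hq, Int.emod_def]
  have hb : -N ≤ 2 * (u - N * q) ∧ 2 * (u - N * q) < N := by constructor <;> linarith
  nlinarith [hb.1, hb.2]

/-- Norm-Euclidean quotient on `ℤ[√−2]`: round both coordinates of `x ȳ / N(y)`. [folklore] -/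
instance : Div (ℤ√(-2)) :=
  ⟨fun x y => ⟨rdiv (x * star y).re y.norm, rdiv (x * star y).im y.norm⟩⟩

/-- The corresponding remainder. [folklore] -/
instance : Mod (ℤ√(-2)) :=
  ⟨fun x y => x - y * (x / y)⟩

/-- Unfolding the quotient. [cite: IrelandRosen1990, Ch. 1, Ex. 36] -/
theorem div_def (x y : ℤ√(-2)) :
    x / y = ⟨rdiv (x * star y).re y.norm, rdiv (x * star y).im y.norm⟩ := rfl

/-- Unfolding the remainder. [cite: IrelandRosen1990, Ch. 1, Ex. 36] -/
theorem mod_def (x y : ℤ√(-2)) : x % y = x - y * (x / y) := rfl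

/-- The norm on `ℤ[√−2]` is `a² + 2b²`. [cite: IrelandRosen1990, Ch. 1, Ex. 36] -/
theorem norm_eq (z : ℤ√(-2)) : z.norm = z.re ^ 2 + 2 * z.im ^ 2 := by
  rw [Zsqrtd.norm_def]; ring

/-- The norm of a non-zero element of `ℤ[√−2]` is positive. [cite: IrelandRosen1990, Ch. 1, Ex. 36] -/
theorem norm_pos_of_ne_zero {y : ℤ√(-2)} (hy : y ≠ 0) : 0 < y.norm := by
  have h0 : y.norm ≠ 0 := fun h => hy ((Zsqrtd.norm_eq_zero_iff (by norm_num) y).mp h)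
  have h1 : 0 ≤ y.norm := Zsqrtd.norm_nonneg (by norm_num) y
  omega

/-- **`ℤ[√−2]` is norm-Euclidean:** `N(x mod y) < N(y)`. [cite: IrelandRosen1990, Ch. 1, Ex. 36] -/
theorem norm_mod_lt (x : ℤ√(-2)) {y : ℤ√(-2)} (hy : y ≠ 0) : (x % y).norm < y.norm := by
  set N := y.norm with hN
  have hNpos : 0 < N := norm_pos_of_ne_zero hy
  set q := x / y with hq
  set r := x % y with hr
  -- `r · ȳ = x ȳ − q N`
  have hyy : y * star y = (N : ℤ√(-2)) := by rw [hN, Zsqrtd.norm_eq_mul_conj]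
  have hrr : r * star y = x * star y - (N : ℤ√(-2)) * q := by
    rw [hr, mod_def, sub_mul, mul_assoc, mul_comm q, ← mul_assoc, hyy]
  have key : ∀ (n : ℤ) (z : ℤ√(-2)),
      ((n : ℤ√(-2)) * z).re = n * z.re ∧ ((n : ℤ√(-2)) * z).im = n * z.im := by
    intro n z
    constructor <;> simp [Zsqrtd.re_mul, Zsqrtd.im_mul, Zsqrtd.re_intCast, Zsqrtd.im_intCast]
  have hre : (r * star y).re = (x * star y).re - N * q.re := by
    rw [hrr, Zsqrtd.re_sub, (key N q).1]
  have him : (r * star y).im = (x * star y).im - N * q.im := by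
    rw [hrr, Zsqrtd.im_sub, (key N q).2]
  have hq1 : q.re = rdiv (x * star y).re N := rfl
  have hq2 : q.im = rdiv (x * star y).im N := rfl
  have b1 := two_mul_abs_sub_rdiv (x * star y).re hNpos
  have b2 := two_mul_abs_sub_rdiv (x * star y).im hNpos
  rw [← hq1] at b1
  rw [← hq2] at b2
  -- `N(r)·N = N(r ȳ) = ρ₁² + 2ρ₂² ≤ N²/4 + N²/2 < N²`
  have hprod : r.norm * N = (r * star y).re ^ 2 + 2 * (r * star y).im ^ 2 := by
    rw [← norm_eq, Zsqrtd.norm_mul, Zsqrtd.norm_conj]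
  rw [hre, him] at hprod
  have h4 : 4 * (r.norm * N) ≤ 3 * N ^ 2 := by rw [hprod]; nlinarith [b1, b2]
  nlinarith [h4, hNpos]

/-- `|N(x mod y)| < |N(y)|`. [cite: IrelandRosen1990, Ch. 1, Ex. 36] -/
theorem natAbs_norm_mod_lt (x : ℤ√(-2)) {y : ℤ√(-2)} (hy : y ≠ 0) :
    (x % y).norm.natAbs < y.norm.natAbs := by
  have h1 := norm_mod_lt x hy
  have h2 : 0 ≤ (x % y).norm := Zsqrtd.norm_nonneg (by norm_num) _
  have h3 : 0 ≤ y.norm := Zsqrtd.norm_nonneg (by norm_num) _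
  omega

/-- `|N(x)| ≤ |N(xy)|` for `y ≠ 0`. [cite: IrelandRosen1990, Ch. 1, Ex. 36] -/
theorem norm_le_norm_mul_left (x : ℤ√(-2)) {y : ℤ√(-2)} (hy : y ≠ 0) :
    x.norm.natAbs ≤ (x * y).norm.natAbs := by
  rw [Zsqrtd.norm_mul, Int.natAbs_mul]
  have h1 : 0 < y.norm := norm_pos_of_ne_zero hy
  have h2 : 1 ≤ y.norm.natAbs := by omega
  exact Nat.le_mul_of_pos_right _ (by omega)

/-- **I&R Ch. 1, Ex. 36: `ℤ[√−2]` is a Euclidean domain.** [cite: IrelandRosen1990, Ch. 1, Ex. 36] -/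
instance : EuclideanDomain (ℤ√(-2)) :=
  { (inferInstance : CommRing (ℤ√(-2))),
    (inferInstance : Nontrivial (ℤ√(-2))) with
    quotient := (· / ·)
    remainder := (· % ·)
    quotient_zero := fun x => by
      rw [div_def]
      ext <;> simp [rdiv, Zsqrtd.norm_def]
    quotient_mul_add_remainder_eq := fun x y => by rw [mod_def]; ring
    r := _
    r_wellFounded := (measure (Int.natAbs ∘ Zsqrtd.norm)).wf
    remainder_lt := natAbs_norm_mod_lt
    mul_left_not_lt := fun a _ hb0 => not_lt_of_ge <| norm_le_norm_mul_left a hb0 }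

/-- The units of `ℤ[√−2]` are `±1`. [cite: IrelandRosen1990, §17.10 ("unique factorization ring with units ±1")] -/
theorem units_eq (u : (ℤ√(-2))ˣ) : (u : ℤ√(-2)) = 1 ∨ (u : ℤ√(-2)) = -1 := by
  have h := (Zsqrtd.norm_eq_one_iff' (by norm_num) (u : ℤ√(-2))).mpr u.isUnit
  rw [norm_eq] at h
  have hb : (u : ℤ√(-2)).im = 0 := by nlinarith [sq_nonneg (u : ℤ√(-2)).re, sq_nonneg (u : ℤ√(-2)).im]
  rw [hb] at h
  have ha : (u : ℤ√(-2)).re = 1 ∨ (u : ℤ√(-2)).re = -1 := by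
    have : ((u : ℤ√(-2)).re - 1) * ((u : ℤ√(-2)).re + 1) = 0 := by nlinarith
    rcases mul_eq_zero.mp this with h1 | h1
    · left; linarith
    · right; linarith
  rcases ha with ha | ha
  · left; ext <;> simp [ha, hb]
  · right; ext <;> simp [ha, hb]

end ZsqrtdNegTwo

open ZsqrtdNegTwo in
/-- **Fermat's theorem on `y² + 2 = x³` (Ireland–Rosen, §17.10):** the only integral solutions of
`y² = x³ − 2` are `(x, y) = (3, ±5)`. [cite: IrelandRosen1990, §17.10, p. 285] -/
theorem sq_add_two_eq_cube {x y : ℤ} (h : y ^ 2 + 2 = x ^ 3) : x = 3 ∧ (y = 5 ∨ y = -5) := by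
  -- `y` odd
  have hy : Odd y := by
    rcases Int.even_or_odd y with ⟨k, hk⟩ | hy
    · exfalso
      rcases Int.even_or_odd x with ⟨l, hl⟩ | ⟨l, hl⟩
      · have : (8 : ℤ) ∣ x ^ 3 := ⟨l ^ 3, by rw [hl]; ring⟩
        rw [← h, hk] at this
        have : (4 : ℤ) ∣ (k + k) ^ 2 + 2 - 4 * k ^ 2 := dvd_sub (dvd_trans ⟨2, by norm_num⟩ this) (dvd_mul_right 4 _)
        have e : (k + k) ^ 2 + 2 - 4 * k ^ 2 = 2 := by ring
        rw [e] at this; norm_num at this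
      · have hodd : Odd (x ^ 3) := (show Odd x from ⟨l, hl⟩).pow
        rw [← h, hk] at hodd
        exact (Int.not_even_iff_odd.mpr hodd) ⟨2 * k ^ 2 + 1, by ring⟩
    · exact hy
  obtain ⟨k, hk⟩ := hy
  -- `A = y + √−2`, `B = y − √−2`, `AB = x³`
  let A : ℤ√(-2) := ⟨y, 1⟩
  let B : ℤ√(-2) := ⟨y, -1⟩
  have hx3 : ((x : ℤ√(-2)) ^ 3) = ⟨x ^ 3, 0⟩ := by
    ext
    · rw [← Int.cast_pow, Zsqrtd.re_intCast]
    · rw [← Int.cast_pow, Zsqrtd.im_intCast]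
  have hAB : A * B = (x : ℤ√(-2)) ^ 3 := by
    rw [hx3]
    ext
    · simp [A, B, Zsqrtd.re_mul]; nlinarith [h]
    · simp [A, B, Zsqrtd.im_mul]
  -- coprimality: `4m − (y² + 2) = 1` with `m = k² + k + 1` gives a Bézout relation
  have hcop : IsCoprime A B := by
    refine ⟨⟨-y, 1 - (k ^ 2 + k + 1)⟩, ⟨0, k ^ 2 + k + 1⟩, ?_⟩
    ext <;> simp [A, B, Zsqrtd.re_mul, Zsqrtd.im_mul] <;> rw [hk] <;> ring
  obtain ⟨γ, u, hu⟩ := exists_associated_pow_of_mul_eq_pow' hcop hAB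
  -- `A = ±γ³ = δ³`
  obtain ⟨δ, hδ⟩ : ∃ δ : ℤ√(-2), δ ^ 3 = A := by
    rcases units_eq u with h1 | h1
    · exact ⟨γ, by rw [← hu, h1, mul_one]⟩
    · exact ⟨-γ, by rw [← hu, h1, mul_neg_one, neg_pow, Odd.neg_one_pow (by decide), neg_one_mul]⟩
  have hcube : δ ^ 3 = ⟨δ.re ^ 3 - 6 * δ.re * δ.im ^ 2, 3 * δ.re ^ 2 * δ.im - 2 * δ.im ^ 3⟩ := by
    have e : δ = ⟨δ.re, δ.im⟩ := by ext <;> rfl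
    conv_lhs => rw [e]
    ext <;> simp [pow_succ, Zsqrtd.re_mul, Zsqrtd.im_mul] <;> ring
  rw [hcube] at hδ
  have him : 3 * δ.re ^ 2 * δ.im - 2 * δ.im ^ 3 = 1 := by
    have := congrArg Zsqrtd.im hδ; simpa [A] using this
  have hre : δ.re ^ 3 - 6 * δ.re * δ.im ^ 2 = y := by
    have := congrArg Zsqrtd.re hδ; simpa [A] using this
  -- `b(3a² − 2b²) = 1`
  set a := δ.re with ha
  set b := δ.im with hb
  have hb1 : b = 1 ∨ b = -1 := by
    have : b * (3 * a ^ 2 - 2 * b ^ 2) = 1 := by linear_combination him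
    exact Int.isUnit_iff.mp (isUnit_of_dvd_one ⟨_, this.symm⟩)
  rcases hb1 with hb1 | hb1
  · rw [hb1] at him hre
    have ha1 : a = 1 ∨ a = -1 := by
      have : (a - 1) * (a + 1) = 0 := by nlinarith
      rcases mul_eq_zero.mp this with h1 | h1
      · left; linarith
      · right; linarith
    have hy5 : y = 5 ∨ y = -5 := by
      rcases ha1 with ha1 | ha1 <;> rw [ha1] at hre <;> norm_num at hre
      · right; linarith
      · left; linarith
    refine ⟨?_, hy5⟩
    have hx3 : x ^ 3 = 27 := by rcases hy5 with h5 | h5 <;> rw [h5] at h <;> linarith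
    have : (x - 3) * (x ^ 2 + 3 * x + 9) = 0 := by linear_combination hx3
    rcases mul_eq_zero.mp this with h1 | h1
    · linarith
    · nlinarith [sq_nonneg (2 * x + 3)]
  · exfalso
    rw [hb1] at him
    norm_num at him
    have h3 : (3 : ℤ) ∣ 1 := ⟨a ^ 2, by linarith⟩
    norm_num at h3

end Literature.NumberTheory.DiophantineGeometry
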